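import Mathlib
import Summits.Ventures.PercRepro2.FirstOrderTerms

/-!
# The first-order (A)-term of row (LEAF-½) at a pendant root is nonnegative
(blind cell PercRepro2, p5 g29; `proofs/P5-OEDGE.md` §39 (12))

With `a₂` a pendant root of weight `t` at `z`, the (A)-term `crossA` of `R½` (`LeafHalfCross.crossA`)
is a cubic in `t` vanishing at `t = 0`; its `t`-coefficient, written with the contracted masses
(`Q = {a₁ ↮ a₂}`, `H = C(a₂)`, `L = C(a₁)`) and the connection probabilities `π_x = P(a₁ ↔ x)`, is

  `crossAfo = P(Q, vH, oL, bL) − π_b·P(Q, vH, oL) + π_o π_b·P(Q, vH) − π_o·P(Q, vH, bL)`.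

**`crossAfo_nonneg`**: `crossAfo ≥ 0` on EVERY finite graph (no pendant structure needed) — by the
exploration of `K = C(a₂)` (`BHKOutside.prob_clusterIn_outside_inter_avoid_eq_expect`): on
`{v ∈ K, a₁ ∉ K}` the `a₁`-events live in `G ∖ K` with conditional probabilities
`g_S(K) = P_{G∖K}(S ↔ a₁)`, and pointwise
`g_ob − π_b g_o + π_o π_b − π_o g_b = (g_ob − g_o g_b) + (π_o − g_o)(π_b − g_b) ≥ 0`
by Harris in `G ∖ K` (`FirstOrder.delClusterProb_mul_le_inter`) and the monotonicity of connection
probabilities under the deletion of `K` (`FirstOrder.delClusterProb_le_beta`).  This is the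
first-order «(A) ≥ 0» at a pendant root — the brick of the pendant-root candidate (PROOT-½) that the
(AA0) witness of §34 cannot touch at first order.  Own work; standard axioms.
-/

namespace Summit.Ventures.PercRepro2

open UnionCluster CovForm CovForm.FirstOrder

namespace LeafRowFirstOrderA

section FO

variable {V : Type*} {E : Type*} [Fintype E] [DecidableEq E] [Fintype V] [DecidableEq V]
  {R : Type*} [Field R] [LinearOrder R] [IsStrictOrderedRing R]

/-- **The first-order (A)-term**: `P(Q, vH, oL, bL) − π_b·P(Q, vH, oL) + π_o π_b·P(Q, vH) −
π_o·P(Q, vH, bL)` (`Q = {a₁ ↮ a₂}`, `H = C(a₂)`, `L = C(a₁)`, `π_x = P(a₁ ↔ x)`). -/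
noncomputable def crossAfo (p : E → R) (ends : E → Sym2 V) (o a₁ a₂ v b : V) : R :=
  prob p (avoidAll ends a₂ {a₁} ∩
      (connEvent ends a₂ v ∩ (connEvent ends a₁ o ∩ connEvent ends a₁ b))) -
    prob p (connEvent ends a₁ b) *
      prob p (avoidAll ends a₂ {a₁} ∩ (connEvent ends a₂ v ∩ connEvent ends a₁ o)) +
    prob p (connEvent ends a₁ o) * prob p (connEvent ends a₁ b) *
      prob p (avoidAll ends a₂ {a₁} ∩ connEvent ends a₂ v) -
    prob p (connEvent ends a₁ o) *
      prob p (avoidAll ends a₂ {a₁} ∩ (connEvent ends a₂ v ∩ connEvent ends a₁ b))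

variable (p : E → R) (ends : E → Sym2 V)

omit [Fintype E] [DecidableEq E] [Fintype V] [DecidableEq V] in
/-- Avoiding nothing is the sure event. -/
lemma avoidAll_empty (s : V) : avoidAll ends s (∅ : Finset V) = Set.univ := by
  ext ω
  simp [avoidAll]

omit [Fintype E] [DecidableEq E] [Fintype V] [DecidableEq V] in
/-- The cluster event of the full family is sure. -/
lemma clusterInEvent_univ (x : V) : clusterInEvent ends x (Set.univ : Set (Set V)) = Set.univ := by
  ext ω
  simp [clusterInEvent]

omit [Fintype V] [DecidableEq V] [LinearOrder R] [IsStrictOrderedRing R] in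
/-- `g_{univ} = 1`. -/
lemma delClusterProb_univ (t : V) (W : Set V) :
    delClusterProb p ends t (Set.univ : Set (Set V)) W = 1 := by
  unfold delClusterProb
  simp

omit [Fintype E] [DecidableEq E] [Fintype V] [DecidableEq V] in
/-- `{a₁ ↔ o} ∩ {a₁ ↔ b}` is the cluster event of `{W | b ∈ W ∧ o ∈ W}`. -/
lemma connEvent_inter_eq_clusterInEvent (a₁ o b : V) :
    connEvent ends a₁ o ∩ connEvent ends a₁ b = clusterInEvent ends a₁ {W | b ∈ W ∧ o ∈ W} := by
  ext ω
  simp only [Set.mem_inter_iff, mem_connEvent, clusterInEvent, Set.mem_setOf_eq, mem_cluster]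
  tauto

omit [Fintype E] [DecidableEq E] [Fintype V] in
/-- The four masses of `crossAfo` as explorations of `C(a₂)`: the set identities. -/
lemma set_four (o a₁ a₂ v b : V) :
    avoidAll ends a₂ {a₁} ∩ (connEvent ends a₂ v ∩ (connEvent ends a₁ o ∩ connEvent ends a₁ b)) =
        clusterInEvent ends a₂ {W | v ∈ W} ∩ clusterInEvent ends a₁ {W | b ∈ W ∧ o ∈ W} ∩
          avoidAll ends a₂ (insert a₁ ∅) ∧
      avoidAll ends a₂ {a₁} ∩ (connEvent ends a₂ v ∩ connEvent ends a₁ o) =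
        clusterInEvent ends a₂ {W | v ∈ W} ∩ clusterInEvent ends a₁ {W | o ∈ W} ∩
          avoidAll ends a₂ (insert a₁ ∅) ∧
      avoidAll ends a₂ {a₁} ∩ connEvent ends a₂ v =
        clusterInEvent ends a₂ {W | v ∈ W} ∩ clusterInEvent ends a₁ Set.univ ∩
          avoidAll ends a₂ (insert a₁ ∅) ∧
      avoidAll ends a₂ {a₁} ∩ (connEvent ends a₂ v ∩ connEvent ends a₁ b) =
        clusterInEvent ends a₂ {W | v ∈ W} ∩ clusterInEvent ends a₁ {W | b ∈ W} ∩
          avoidAll ends a₂ (insert a₁ ∅) := by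
  rw [Finset.insert_empty, clusterInEvent_univ]
  refine ⟨?_, ?_, ?_, ?_⟩ <;> ext ω <;>
    simp only [Set.mem_inter_iff, mem_connEvent, clusterInEvent, Set.mem_setOf_eq, mem_cluster,
      Set.mem_univ, and_true] <;> tauto

omit [LinearOrder R] [IsStrictOrderedRing R] in
/-- **`crossAfo` as one expectation over the cluster `K = C(a₂)`**: the integrand is
`1[v ∈ K] · (g_ob − π_b g_o + π_o π_b g_univ − π_o g_b)(K)` with `g = outsideProb`. -/
lemma crossAfo_eq_expect (o a₁ a₂ v b : V) :
    crossAfo p ends o a₁ a₂ v b =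
      expect p (fun ω =>
        ({W : Set V | v ∈ W}.indicator 1 (cluster ends ω a₂)) *
          (outsideProb p ends a₁ {W | b ∈ W ∧ o ∈ W} (cluster ends ω a₂) -
            prob p (connEvent ends a₁ b) * outsideProb p ends a₁ {W | o ∈ W} (cluster ends ω a₂) +
            prob p (connEvent ends a₁ o) * prob p (connEvent ends a₁ b) *
              outsideProb p ends a₁ Set.univ (cluster ends ω a₂) -
            prob p (connEvent ends a₁ o) *
              outsideProb p ends a₁ {W | b ∈ W} (cluster ends ω a₂))) := by
  obtain ⟨h1, h2, h3, h4⟩ := set_four ends o a₁ a₂ v b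
  unfold crossAfo
  rw [h1, h2, h3, h4, prob_clusterIn_outside_inter_avoid_eq_expect,
    prob_clusterIn_outside_inter_avoid_eq_expect, prob_clusterIn_outside_inter_avoid_eq_expect,
    prob_clusterIn_outside_inter_avoid_eq_expect, avoidAll_empty]
  simp only [Set.indicator_univ, Pi.one_apply, mul_one]
  rw [← expect_const_mul, ← expect_const_mul, ← expect_const_mul, ← expect_sub, ← expect_add,
    ← expect_sub]
  congr 1
  funext ω
  simp only [Pi.sub_apply, Pi.add_apply]
  ring

/-- **THEOREM: the first-order (A)-term is nonnegative** — Harris in `G ∖ C(a₂)` and the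
monotonicity of the `a₁`-connection probabilities under the deletion of `C(a₂)`, pointwise on the
explored cluster. -/
theorem crossAfo_nonneg (hp : IsProbVec p) (o a₁ a₂ v b : V) :
    0 ≤ crossAfo p ends o a₁ a₂ v b := by
  rw [crossAfo_eq_expect]
  refine expect_nonneg hp fun ω => ?_
  have hind : 0 ≤ ({W : Set V | v ∈ W}.indicator (1 : Set V → R) (cluster ends ω a₂)) :=
    Set.indicator_apply_nonneg fun _ => zero_le_one
  refine mul_nonneg hind ?_
  by_cases ha : a₁ ∈ cluster ends ω a₂
  · rw [outsideProb_apply_of_mem p _ ha, outsideProb_apply_of_mem p _ ha,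
      outsideProb_apply_of_mem p _ ha, outsideProb_apply_of_mem p _ ha]
    ring_nf
    exact le_rfl
  · rw [outsideProb_apply_of_notMem p _ ha, outsideProb_apply_of_notMem p _ ha,
      outsideProb_apply_of_notMem p _ ha, outsideProb_apply_of_notMem p _ ha,
      delClusterProb_univ]
    have hH := delClusterProb_mul_le_inter p hp ends a₁ b o (cluster ends ω a₂)
    have hb := delClusterProb_le_beta p hp ends a₁ b (cluster ends ω a₂)
    have ho := delClusterProb_le_beta p hp ends a₁ o (cluster ends ω a₂)
    unfold beta at hb ho
    have hb0 := delClusterProb_nonneg p hp ends a₁ {W | b ∈ W} (cluster ends ω a₂)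
    have ho0 := delClusterProb_nonneg p hp ends a₁ {W | o ∈ W} (cluster ends ω a₂)
    have hprod := mul_nonneg (sub_nonneg.2 ho) (sub_nonneg.2 hb)
    nlinarith [hH, hprod, hb0, ho0]

end FO

end LeafRowFirstOrderA

end Summit.Ventures.PercRepro2
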